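import Summits.AnomalousDissipation.AnomalousDissipation.Theorems.SawtoothPulseCascadeApproxAssembly

/-!
# The response envelope from K2″ WITHIN THE HORIZON only
(route `AnomalousDissipation/SawtoothPulseCascade`; helper for the crux K1loc = stmt-AnomalousDissipation-19491 — the
weakest form of the K2 crux that the closure K1loc ∧ K2 → Target consumes)

The landed pipeline `piece_bound` → `response_phase_envelope` → `response_envelope_of_budget` (files `…ApproxPieces`,
`…ApproxAssembly`) takes the K2″ property at viscosity `ν` for ALL pairs of phases `j₀ ≤ J'`, but APPLIES it only at
`J' ≤ J`, the top phase of the window (`tStart (J+1) ≤ T'`; in the closure `J + 1 = J_{γ²−3}(ν) + A` is the horizon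
phase).  This file is the same pipeline with the hypothesis restricted accordingly
(`hK2ν : ∀ j₀ J', j₀ ≤ J' → J' ≤ J → …`): `piece_boundH`, `response_phase_envelopeH`, `response_envelope_of_budgetH` —
proofs verbatim, the bound `J' ≤ J` threaded through.  Downstream (`…ApproxEnvelopePH`) this yields the closure from a
per-phase cap that is only required up to the horizon phase, i.e. in the regime where the analyticity budget
`16π²νN_j²tHalf_j ≤ δ_j²` holds (viscosity perturbative at the corner scale).
-/

set_option linter.dupNamespace false

noncomputable section

namespace Summit.AnomalousDissipation.AnomalousDissipation.Theorems.SawtoothPulseCascade.ApproxResponse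

open Set MeasureTheory UnitAddTorus
open scoped ContDiff InnerProductSpace
open Literature.Analysis Literature.Analysis.FunctionSpaces Literature.Analysis.FluidPDE
open Literature.Analysis.FluidPDE.SawtoothCascade
open Literature.Analysis.FluidPDE.SawtoothCascade.CascadeParams
open Summit.AnomalousDissipation.AnomalousDissipation.Theorems.SawtoothPulseCascade.K2Classical

/-! ## §1 K2″ within the horizon caps a realigned piece -/

/-- **K2″ up to phase `Jm` caps a realigned piece on every phase `J ≤ Jm`** (`piece_bound` with the K2 hypothesis
restricted to top phases `≤ Jm`). -/
theorem piece_boundH (P : CascadeParams) {C ν T' G : ℝ} {Jm : ℕ} (hC : 0 ≤ C) (hG : 0 ≤ G)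
    (hK2ν : ∀ (j₀ J : ℕ), j₀ ≤ J → J ≤ Jm → ∀ (hz : Bool)
      (w₀ : UnitAddTorus (Fin 2) → EuclideanSpace ℝ (Fin 2))
      (w : ℝ → UnitAddTorus (Fin 2) → EuclideanSpace ℝ (Fin 2)) (q : ℝ → UnitAddTorus (Fin 2) → ℝ),
      ShearCombDatum (P.N j₀) hz w₀ →
      Torus.IsSmoothSpaceTimeOn (Icc (CascadeParams.tInject j₀ hz) (CascadeParams.tStart (J + 1))) w →
      Torus.IsSmoothSpaceTimeOn (Icc (CascadeParams.tInject j₀ hz) (CascadeParams.tStart (J + 1))) q →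
      (∀ t ∈ Icc (CascadeParams.tInject j₀ hz) (CascadeParams.tStart (J + 1)), Torus.IsDivFree (w t)) →
      (∀ t ∈ Icc (CascadeParams.tInject j₀ hz) (CascadeParams.tStart (J + 1)), ∀ x,
        Torus.timeDerivWithin (Icc (CascadeParams.tInject j₀ hz) (CascadeParams.tStart (J + 1))) w t x +
          Torus.convect (P.field t) (w t) x + Torus.convect (w t) (P.field t) x =
          ν • Torus.laplacian (w t) x - Torus.gradient (q t) x) →
      w (CascadeParams.tInject j₀ hz) = w₀ →
      ∀ t ∈ Icc (max (CascadeParams.tInject j₀ hz) (CascadeParams.tStart J)) (CascadeParams.tStart (J + 1)),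
        Torus.vectorL2Sq (w t) ≤ (C * Real.exp (sawSigmaStar * P.γ)) ^ (2 * (J + 1 - j₀)) * Torus.vectorL2Sq w₀)
    {j₀ : ℕ} {hz : Bool} {w₀ : UnitAddTorus (Fin 2) → EuclideanSpace ℝ (Fin 2)}
    (hdat : ShearCombDatum (P.N j₀) hz w₀) (hw₀ : Torus.vectorL2Sq w₀ ≤ G ^ 2)
    {W : ℝ → UnitAddTorus (Fin 2) → EuclideanSpace ℝ (Fin 2)} {R : ℝ → UnitAddTorus (Fin 2) → ℝ}
    (hW : Torus.IsSmoothSpaceTimeOn (Icc (CascadeParams.tInject j₀ hz) T') W)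
    (hR : Torus.IsSmoothSpaceTimeOn (Icc (CascadeParams.tInject j₀ hz) T') R)
    (hWdiv : ∀ t ∈ Icc (CascadeParams.tInject j₀ hz) T', Torus.IsDivFree (W t))
    (hWlin : ∀ t ∈ Icc (CascadeParams.tInject j₀ hz) T', ∀ x,
      Torus.timeDerivWithin (Icc (CascadeParams.tInject j₀ hz) T') W t x +
        Torus.convect (P.field t) (W t) x + Torus.convect (W t) (P.field t) x =
          ν • Torus.laplacian (W t) x - Torus.gradient (R t) x)
    (hW0 : W (CascadeParams.tInject j₀ hz) = w₀)
    {J : ℕ} (hJ : j₀ ≤ J) (hJm : J ≤ Jm) (hJT : CascadeParams.tStart (J + 1) ≤ T')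
    {t : ℝ} (ht : t ∈ Icc (max (CascadeParams.tInject j₀ hz) (CascadeParams.tStart J)) (CascadeParams.tStart (J + 1))) :
    Real.sqrt (Torus.vectorL2Sq (W t)) ≤ (C * Real.exp (sawSigmaStar * P.γ)) ^ (J + 1 - j₀) * G := by
  have hlt : CascadeParams.tInject j₀ hz < CascadeParams.tStart (J + 1) :=
    (tInject_lt_tStart_succ j₀ hz).trans_le (tStart_strictMono.monotone (Nat.succ_le_succ hJ))
  have hsub : Icc (CascadeParams.tInject j₀ hz) (CascadeParams.tStart (J + 1)) ⊆ Icc (CascadeParams.tInject j₀ hz) T' :=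
    Icc_subset_Icc le_rfl hJT
  have hlin' : ∀ s ∈ Icc (CascadeParams.tInject j₀ hz) (CascadeParams.tStart (J + 1)), ∀ x,
      Torus.timeDerivWithin (Icc (CascadeParams.tInject j₀ hz) (CascadeParams.tStart (J + 1))) W s x +
        Torus.convect (P.field s) (W s) x + Torus.convect (W s) (P.field s) x =
          ν • Torus.laplacian (W s) x - Torus.gradient (R s) x := by
    intro s hs x
    rw [timeDerivWithin_Icc_eq_of_subset hlt hsub hW hs x]
    exact hWlin s (hsub hs) x
  have h := hK2ν j₀ J hJ hJm hz w₀ W R hdat (hW.mono hsub) (hR.mono hsub) (fun s hs => hWdiv s (hsub hs)) hlin' hW0 t ht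
  have hE : 0 ≤ C * Real.exp (sawSigmaStar * P.γ) := mul_nonneg hC (Real.exp_pos _).le
  have h2 : Torus.vectorL2Sq (W t) ≤ ((C * Real.exp (sawSigmaStar * P.γ)) ^ (J + 1 - j₀) * G) ^ 2 := by
    calc Torus.vectorL2Sq (W t) ≤ (C * Real.exp (sawSigmaStar * P.γ)) ^ (2 * (J + 1 - j₀)) * Torus.vectorL2Sq w₀ := h
      _ ≤ (C * Real.exp (sawSigmaStar * P.γ)) ^ (2 * (J + 1 - j₀)) * G ^ 2 :=
          mul_le_mul_of_nonneg_left hw₀ (pow_nonneg hE _)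
      _ = ((C * Real.exp (sawSigmaStar * P.γ)) ^ (J + 1 - j₀) * G) ^ 2 := by rw [pow_mul']; ring
  calc Real.sqrt (Torus.vectorL2Sq (W t)) ≤ Real.sqrt (((C * Real.exp (sawSigmaStar * P.γ)) ^ (J + 1 - j₀) * G) ^ 2) :=
        Real.sqrt_le_sqrt h2
    _ = (C * Real.exp (sawSigmaStar * P.γ)) ^ (J + 1 - j₀) * G := Real.sqrt_sq (mul_nonneg (pow_nonneg hE _) hG)


/-! ## §3 The phase envelope -/

/-! ## §2 The phase envelope from K2″ within the window -/

section Envelope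

variable (P : CascadeParams) {ν T' : ℝ}
  {W : ℕ → ℝ → UnitAddTorus (Fin 2) → EuclideanSpace ℝ (Fin 2)} {g : ℕ → ℝ → ℝ} {G : ℕ → ℝ}

/-- **The phase envelope of the forced response from K2″ restricted to the phases `≤ J` of the window**
(`response_phase_envelope` with `hK2ν : ∀ j₀ J', j₀ ≤ J' → J' ≤ J → …`). -/
theorem response_phase_envelopeH {J : ℕ} (hδ₀ : 0 < P.δ₀) (hd : 0 < P.d) (hγ : 0 ≤ P.γ) (hN : ∀ j, P.N j ≠ 0)
    (hν : 0 < ν) {C : ℝ} (hC : 0 ≤ C)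
    (hK2ν : ∀ (j₀ J' : ℕ), j₀ ≤ J' → J' ≤ J → ∀ (hz : Bool)
      (w₀ : UnitAddTorus (Fin 2) → EuclideanSpace ℝ (Fin 2))
      (w : ℝ → UnitAddTorus (Fin 2) → EuclideanSpace ℝ (Fin 2)) (q : ℝ → UnitAddTorus (Fin 2) → ℝ),
      ShearCombDatum (P.N j₀) hz w₀ →
      Torus.IsSmoothSpaceTimeOn (Icc (CascadeParams.tInject j₀ hz) (CascadeParams.tStart (J' + 1))) w →
      Torus.IsSmoothSpaceTimeOn (Icc (CascadeParams.tInject j₀ hz) (CascadeParams.tStart (J' + 1))) q →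
      (∀ t ∈ Icc (CascadeParams.tInject j₀ hz) (CascadeParams.tStart (J' + 1)), Torus.IsDivFree (w t)) →
      (∀ t ∈ Icc (CascadeParams.tInject j₀ hz) (CascadeParams.tStart (J' + 1)), ∀ x,
        Torus.timeDerivWithin (Icc (CascadeParams.tInject j₀ hz) (CascadeParams.tStart (J' + 1))) w t x +
          Torus.convect (P.field t) (w t) x + Torus.convect (w t) (P.field t) x =
          ν • Torus.laplacian (w t) x - Torus.gradient (q t) x) →
      w (CascadeParams.tInject j₀ hz) = w₀ →
      ∀ t ∈ Icc (max (CascadeParams.tInject j₀ hz) (CascadeParams.tStart J')) (CascadeParams.tStart (J' + 1)),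
        Torus.vectorL2Sq (w t) ≤ (C * Real.exp (sawSigmaStar * P.γ)) ^ (2 * (J' + 1 - j₀)) * Torus.vectorL2Sq w₀)
    (hJT : tStart (J + 1) ≤ T')
    {L : ℝ → UnitAddTorus (Fin 2) → EuclideanSpace ℝ (Fin 2)} {q : ℝ → UnitAddTorus (Fin 2) → ℝ}
    (hL : Torus.IsSmoothSpaceTimeOn (Icc 0 T') L) (hq : Torus.IsSmoothSpaceTimeOn (Icc 0 T') q)
    (hLdiv : ∀ t ∈ Icc 0 T', Torus.IsDivFree (L t)) (hL0 : L 0 = fun _ => 0)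
    (hlin : ∀ t ∈ Icc 0 T', ∀ x, Torus.timeDerivWithin (Icc 0 T') L t x + Torus.convect (P.field t) (L t) x +
      Torus.convect (L t) (P.field t) x =
        ν • Torus.laplacian (L t) x - Torus.gradient (q t) x + ν • Torus.laplacian (P.field t) x)
    (hg : ∀ k < 2 * (J + 1), ContDiff ℝ ∞ (g k) ∧ Function.Periodic (g k) 1)
    (hcomb : ∀ k < 2 * (J + 1), ∀ m : ℤ, (¬ ∃ n : ℤ, m = (2 * n + 1) * (P.N (k / 2) : ℤ)) →
      fourierCoeff (AddCircle.liftIco 1 0 fun y => (g k y : ℂ)) m = 0)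
    (hG0 : ∀ k, 0 ≤ G k) (hGk : ∀ k < 2 * (J + 1), ∀ y, |g k y| ≤ G k)
    (hrealH : ∀ j, 2 * j < 2 * (J + 1) → ∀ c F : ℝ → ℝ → ℝ,
        ContDiffOn ℝ ∞ (Function.uncurry c) (Icc (tStart j) (tStart j + tHalf j) ×ˢ univ) →
        (∀ t ∈ Icc (tStart j) (tStart j + tHalf j), Function.Periodic (c t) 1) →
        (∀ t ∈ Icc (tStart j) (tStart j + tHalf j), ∀ y,
          derivWithin (fun s => c s y) (Icc (tStart j) (tStart j + tHalf j)) t = ν * deriv (deriv (c t)) y) →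
        c (tStart j) = g (2 * j) →
        ContDiffOn ℝ ∞ (Function.uncurry F) (Icc (tStart j) (tStart j + tHalf j) ×ˢ univ) →
        (∀ t ∈ Icc (tStart j) (tStart j + tHalf j), Function.Periodic (F t) 1) → F (tStart j) = (fun _ => 0) →
        (∀ t ∈ Icc (tStart j) (tStart j + tHalf j), ∀ y,
          derivWithin (fun s => F s y) (Icc (tStart j) (tStart j + tHalf j)) t =
            ν * deriv (deriv (F t)) y + ν * (P.rateH j t * deriv (deriv (P.U j)) y)) →
        c (tStart j + tHalf j) = F (tStart j + tHalf j))
    (hrealV : ∀ j, 2 * j + 1 < 2 * (J + 1) → ∀ c F : ℝ → ℝ → ℝ,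
        ContDiffOn ℝ ∞ (Function.uncurry c) (Icc (tStart j + tHalf j) (tStart (j + 1)) ×ˢ univ) →
        (∀ t ∈ Icc (tStart j + tHalf j) (tStart (j + 1)), Function.Periodic (c t) 1) →
        (∀ t ∈ Icc (tStart j + tHalf j) (tStart (j + 1)), ∀ y,
          derivWithin (fun s => c s y) (Icc (tStart j + tHalf j) (tStart (j + 1))) t = ν * deriv (deriv (c t)) y) →
        c (tStart j + tHalf j) = g (2 * j + 1) →
        ContDiffOn ℝ ∞ (Function.uncurry F) (Icc (tStart j + tHalf j) (tStart (j + 1)) ×ˢ univ) →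
        (∀ t ∈ Icc (tStart j + tHalf j) (tStart (j + 1)), Function.Periodic (F t) 1) →
        F (tStart j + tHalf j) = (fun _ => 0) →
        (∀ t ∈ Icc (tStart j + tHalf j) (tStart (j + 1)), ∀ y,
          derivWithin (fun s => F s y) (Icc (tStart j + tHalf j) (tStart (j + 1))) t =
            ν * deriv (deriv (F t)) y + ν * (P.rateV j t * deriv (deriv (P.U j)) y)) →
        c (tStart (j + 1)) = F (tStart (j + 1)))
    {R : ℕ → ℝ → UnitAddTorus (Fin 2) → ℝ}
    (hW : ∀ i < 2 * (J + 1), Torus.IsSmoothSpaceTimeOn (Icc (CascadeParams.tInject (i / 2) (i % 2 == 0)) T') (W i))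
    (hR : ∀ i < 2 * (J + 1), Torus.IsSmoothSpaceTimeOn (Icc (CascadeParams.tInject (i / 2) (i % 2 == 0)) T') (R i))
    (hWdiv : ∀ i < 2 * (J + 1), ∀ t ∈ Icc (CascadeParams.tInject (i / 2) (i % 2 == 0)) T', Torus.IsDivFree (W i t))
    (hWlin : ∀ i < 2 * (J + 1), ∀ t ∈ Icc (CascadeParams.tInject (i / 2) (i % 2 == 0)) T', ∀ x,
      Torus.timeDerivWithin (Icc (CascadeParams.tInject (i / 2) (i % 2 == 0)) T') (W i) t x +
        Torus.convect (P.field t) (W i t) x + Torus.convect (W i t) (P.field t) x =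
          ν • Torus.laplacian (W i t) x - Torus.gradient (R i t) x)
    (hW0H : ∀ j, 2 * j < 2 * (J + 1) → W (2 * j) (tStart j) =
      fun x => g (2 * j) (Torus.repr x 1) • EuclideanSpace.single (0 : Fin 2) (1 : ℝ))
    (hW0V : ∀ j, 2 * j + 1 < 2 * (J + 1) → W (2 * j + 1) (tStart j + tHalf j) =
      fun x => g (2 * j + 1) (Torus.repr x 0) • EuclideanSpace.single (1 : Fin 2) (1 : ℝ))
    {k : ℕ} (hk : k < 2 * (J + 1)) {t : ℝ}
    (ht : t ∈ Icc (CascadeParams.tInject (k / 2) (k % 2 == 0)) (CascadeParams.tInject ((k + 1) / 2) ((k + 1) % 2 == 0))) :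
    Real.sqrt (Torus.vectorL2Sq (L t)) ≤
      ∑ i ∈ Finset.range k, (C * Real.exp (sawSigmaStar * P.γ)) ^ (k / 2 + 1 - i / 2) * G i +
        6 * Real.sqrt (2 * Real.pi) * ν * (P.N (k / 2)) * P.γ / P.δ (k / 2) := by
  have hK : CascadeParams.tInject (2 * (J + 1) / 2) (2 * (J + 1) % 2 == 0) ≤ T' := by
    rw [slotStart_even (J + 1)]; exact hJT
  have hslot := response_slot_bound P hδ₀ hd hγ hN hν hK hL hq hLdiv hL0 hlin hg hrealH hrealV hW hR hWdiv hWlin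
    hW0H hW0V hk ht
  refine hslot.trans (add_le_add (Finset.sum_le_sum fun i hi => ?_) le_rfl)
  have hi' : i < k := Finset.mem_range.1 hi
  have hiK : i < 2 * (J + 1) := hi'.trans hk
  obtain ⟨hdat, hsize⟩ := piece_datum P hg hcomb hG0 hGk hW0H hW0V hiK
  -- phase of slot `k`
  have hkJ : k / 2 ≤ J := by omega
  have hJ'T : tStart (k / 2 + 1) ≤ T' := (tStart_strictMono.monotone (Nat.succ_le_succ hkJ)).trans hJT
  have hij : i / 2 ≤ k / 2 := Nat.div_le_div_right hi'.le
  have htK2 : t ∈ Icc (max (CascadeParams.tInject (i / 2) (i % 2 == 0)) (tStart (k / 2))) (tStart (k / 2 + 1)) := by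
    refine ⟨max_le ((slotStart_mono hi'.le).trans ht.1) ((tStart_half_le_slotStart k).trans ht.1), ?_⟩
    exact ht.2.trans (slotStart_succ_le_tStart k)
  exact piece_boundH P hC (hG0 i) hK2ν hdat hsize (hW i hiK) (hR i hiK) (hWdiv i hiK) (hWlin i hiK) rfl hij hkJ hJ'T htK2

end Envelope

/-! ## §3 Assembly at an admissible viscosity from K2″ within the window -/

section Assembly

variable (P : CascadeParams) {ν C T' : ℝ} {J : ℕ}

/-- **The phase envelope at an admissible viscosity, K2″ only up to the top phase `J`**
(`response_envelope_of_budget` with `hK2ν : ∀ j₀ J', j₀ ≤ J' → J' ≤ J → …`): on slot `k < 2(J+1)`,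
`√∫‖L(t)‖² ≤ Σ_{i<k} (C e^{σ⋆γ})^{k/2+1−i/2} · 12√π ν γ N_{i/2}/δ_{i/2} + 6√(2π) ν γ N_{k/2}/δ_{k/2}`. -/
theorem response_envelope_of_budgetH (hδ₀ : 0 < P.δ₀) (hd : 0 < P.d) (hγ : 0 ≤ P.γ) (hN : ∀ j, P.N j ≠ 0)
    (hν : 0 < ν) (hC : 0 ≤ C)
    (hK2ν : ∀ (j₀ J' : ℕ), j₀ ≤ J' → J' ≤ J → ∀ (hz : Bool)
      (w₀ : UnitAddTorus (Fin 2) → EuclideanSpace ℝ (Fin 2))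
      (w : ℝ → UnitAddTorus (Fin 2) → EuclideanSpace ℝ (Fin 2)) (q : ℝ → UnitAddTorus (Fin 2) → ℝ),
      ShearCombDatum (P.N j₀) hz w₀ →
      Torus.IsSmoothSpaceTimeOn (Icc (CascadeParams.tInject j₀ hz) (CascadeParams.tStart (J' + 1))) w →
      Torus.IsSmoothSpaceTimeOn (Icc (CascadeParams.tInject j₀ hz) (CascadeParams.tStart (J' + 1))) q →
      (∀ t ∈ Icc (CascadeParams.tInject j₀ hz) (CascadeParams.tStart (J' + 1)), Torus.IsDivFree (w t)) →
      (∀ t ∈ Icc (CascadeParams.tInject j₀ hz) (CascadeParams.tStart (J' + 1)), ∀ x,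
        Torus.timeDerivWithin (Icc (CascadeParams.tInject j₀ hz) (CascadeParams.tStart (J' + 1))) w t x +
          Torus.convect (P.field t) (w t) x + Torus.convect (w t) (P.field t) x =
          ν • Torus.laplacian (w t) x - Torus.gradient (q t) x) →
      w (CascadeParams.tInject j₀ hz) = w₀ →
      ∀ t ∈ Icc (max (CascadeParams.tInject j₀ hz) (CascadeParams.tStart J')) (CascadeParams.tStart (J' + 1)),
        Torus.vectorL2Sq (w t) ≤ (C * Real.exp (sawSigmaStar * P.γ)) ^ (2 * (J' + 1 - j₀)) * Torus.vectorL2Sq w₀)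
    (hbud : ∀ j ≤ J, 16 * Real.pi ^ 2 * ν * (P.N j : ℝ) ^ 2 * tHalf j ≤ P.δ j ^ 2)
    (hJT : tStart (J + 1) ≤ T') (hT'1 : T' < 1)
    {L : ℝ → UnitAddTorus (Fin 2) → EuclideanSpace ℝ (Fin 2)} {q : ℝ → UnitAddTorus (Fin 2) → ℝ}
    (hL : Torus.IsSmoothSpaceTimeOn (Icc 0 T') L) (hq : Torus.IsSmoothSpaceTimeOn (Icc 0 T') q)
    (hLdiv : ∀ t ∈ Icc 0 T', Torus.IsDivFree (L t)) (hL0 : L 0 = fun _ => 0)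
    (hlin : ∀ t ∈ Icc 0 T', ∀ x, Torus.timeDerivWithin (Icc 0 T') L t x + Torus.convect (P.field t) (L t) x +
      Torus.convect (L t) (P.field t) x =
        ν • Torus.laplacian (L t) x - Torus.gradient (q t) x + ν • Torus.laplacian (P.field t) x)
    {k : ℕ} (hk : k < 2 * (J + 1)) {t : ℝ}
    (ht : t ∈ Icc (CascadeParams.tInject (k / 2) (k % 2 == 0)) (CascadeParams.tInject ((k + 1) / 2) ((k + 1) % 2 == 0))) :
    Real.sqrt (Torus.vectorL2Sq (L t)) ≤
      ∑ i ∈ Finset.range k, (C * Real.exp (sawSigmaStar * P.γ)) ^ (k / 2 + 1 - i / 2) *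
          (12 * Real.sqrt Real.pi * ν * P.γ * (P.N (i / 2)) / P.δ (i / 2)) +
        6 * Real.sqrt (2 * Real.pi) * ν * (P.N (k / 2)) * P.γ / P.δ (k / 2) := by
  have hδ : ∀ j, 0 < P.δ j := fun j => P.δ_pos hδ₀ hd j
  have hbud' : ∀ j ≤ J, 8 * Real.pi ^ 2 * ν * (P.N j : ℝ) ^ 2 * tHalf j < P.δ j ^ 2 :=
    fun j hj => (budget_facts (hδ j) hν (tHalf_pos j) (hN j) (hbud j hj)).1
  -- Step 1: the realigned comb profiles, phase by phase (H and V)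
  have hexH : ∀ j : ℕ, ∃ g : ℝ → ℝ, j ≤ J → (ContDiff ℝ ∞ g ∧ Function.Periodic g 1 ∧
      (∀ m : ℤ, (¬ ∃ n : ℤ, m = (2 * n + 1) * (P.N j : ℤ)) →
        fourierCoeff (AddCircle.liftIco 1 0 fun y => (g y : ℂ)) m = 0) ∧
      (∀ y, |g y| ≤ 6 * Real.sqrt (2 * Real.pi) * ν * (P.N j) * P.γ /
        Real.sqrt (P.δ j ^ 2 - 8 * Real.pi ^ 2 * ν * (P.N j : ℝ) ^ 2 * tHalf j)) ∧
      (∀ c F : ℝ → ℝ → ℝ,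
        ContDiffOn ℝ ∞ (Function.uncurry c) (Icc (tStart j) (tStart j + tHalf j) ×ˢ univ) →
        (∀ t ∈ Icc (tStart j) (tStart j + tHalf j), Function.Periodic (c t) 1) →
        (∀ t ∈ Icc (tStart j) (tStart j + tHalf j), ∀ y,
          derivWithin (fun s => c s y) (Icc (tStart j) (tStart j + tHalf j)) t = ν * deriv (deriv (c t)) y) →
        c (tStart j) = g →
        ContDiffOn ℝ ∞ (Function.uncurry F) (Icc (tStart j) (tStart j + tHalf j) ×ˢ univ) →
        (∀ t ∈ Icc (tStart j) (tStart j + tHalf j), Function.Periodic (F t) 1) → F (tStart j) = (fun _ => 0) →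
        (∀ t ∈ Icc (tStart j) (tStart j + tHalf j), ∀ y,
          derivWithin (fun s => F s y) (Icc (tStart j) (tStart j + tHalf j)) t =
            ν * deriv (deriv (F t)) y + ν * (P.rateH j t * deriv (deriv (P.U j)) y)) →
        c (tStart j + tHalf j) = F (tStart j + tHalf j))) := by
    intro j
    by_cases hj : j ≤ J
    · obtain ⟨g, h1, h2, h3, h4, h5⟩ := exists_realigned_H P hδ₀ hd hγ (hN j) hν (hbud' j hj)
      exact ⟨g, fun _ => ⟨h1, h2, h3, h4, h5⟩⟩
    · exact ⟨fun _ => 0, fun h => absurd h hj⟩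
  have hexV : ∀ j : ℕ, ∃ g : ℝ → ℝ, j ≤ J → (ContDiff ℝ ∞ g ∧ Function.Periodic g 1 ∧
      (∀ m : ℤ, (¬ ∃ n : ℤ, m = (2 * n + 1) * (P.N j : ℤ)) →
        fourierCoeff (AddCircle.liftIco 1 0 fun y => (g y : ℂ)) m = 0) ∧
      (∀ y, |g y| ≤ 6 * Real.sqrt (2 * Real.pi) * ν * (P.N j) * P.γ /
        Real.sqrt (P.δ j ^ 2 - 8 * Real.pi ^ 2 * ν * (P.N j : ℝ) ^ 2 * tHalf j)) ∧
      (∀ c F : ℝ → ℝ → ℝ,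
        ContDiffOn ℝ ∞ (Function.uncurry c) (Icc (tStart j + tHalf j) (tStart (j + 1)) ×ˢ univ) →
        (∀ t ∈ Icc (tStart j + tHalf j) (tStart (j + 1)), Function.Periodic (c t) 1) →
        (∀ t ∈ Icc (tStart j + tHalf j) (tStart (j + 1)), ∀ y,
          derivWithin (fun s => c s y) (Icc (tStart j + tHalf j) (tStart (j + 1))) t = ν * deriv (deriv (c t)) y) →
        c (tStart j + tHalf j) = g →
        ContDiffOn ℝ ∞ (Function.uncurry F) (Icc (tStart j + tHalf j) (tStart (j + 1)) ×ˢ univ) →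
        (∀ t ∈ Icc (tStart j + tHalf j) (tStart (j + 1)), Function.Periodic (F t) 1) →
        F (tStart j + tHalf j) = (fun _ => 0) →
        (∀ t ∈ Icc (tStart j + tHalf j) (tStart (j + 1)), ∀ y,
          derivWithin (fun s => F s y) (Icc (tStart j + tHalf j) (tStart (j + 1))) t =
            ν * deriv (deriv (F t)) y + ν * (P.rateV j t * deriv (deriv (P.U j)) y)) →
        c (tStart (j + 1)) = F (tStart (j + 1)))) := by
    intro j
    by_cases hj : j ≤ J
    · obtain ⟨g, h1, h2, h3, h4, h5⟩ := exists_realigned_V P hδ₀ hd hγ (hN j) hν (hbud' j hj)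
      exact ⟨g, fun _ => ⟨h1, h2, h3, h4, h5⟩⟩
    · exact ⟨fun _ => 0, fun h => absurd h hj⟩
  choose gH hgH using hexH
  choose gV hgV using hexV
  -- the slot-indexed profiles and sizes
  set g : ℕ → ℝ → ℝ := fun k => if k % 2 = 0 then gH (k / 2) else gV (k / 2) with hg_def
  set G : ℕ → ℝ := fun k => 6 * Real.sqrt (2 * Real.pi) * ν * (P.N (k / 2)) * P.γ /
    Real.sqrt (P.δ (k / 2) ^ 2 - 8 * Real.pi ^ 2 * ν * (P.N (k / 2) : ℝ) ^ 2 * tHalf (k / 2)) with hG_def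
  have hg_even : ∀ j, g (2 * j) = gH j := fun j => by
    simp only [hg_def, Nat.mul_mod_right, ↓reduceIte, show 2 * j / 2 = j by omega]
  have hg_odd : ∀ j, g (2 * j + 1) = gV j := fun j => by
    simp only [hg_def, show (2 * j + 1) % 2 = 1 by omega, one_ne_zero, ↓reduceIte, show (2 * j + 1) / 2 = j by omega]
  have hkJ : ∀ {k : ℕ}, k < 2 * (J + 1) → k / 2 ≤ J := fun hk => by omega
  -- properties of `g k` for `k < 2(J+1)`
  have hgk : ∀ k < 2 * (J + 1), ContDiff ℝ ∞ (g k) ∧ Function.Periodic (g k) 1 ∧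
      (∀ m : ℤ, (¬ ∃ n : ℤ, m = (2 * n + 1) * (P.N (k / 2) : ℤ)) →
        fourierCoeff (AddCircle.liftIco 1 0 fun y => (g k y : ℂ)) m = 0) ∧
      (∀ y, |g k y| ≤ G k) := by
    intro k hk
    obtain ⟨j, rfl | rfl⟩ := Nat.even_or_odd' k
    · obtain ⟨h1, h2, h3, h4, -⟩ := hgH j (by omega)
      rw [hg_even]
      refine ⟨h1, h2, by simpa [show 2 * j / 2 = j by omega] using h3, fun y => ?_⟩
      simp only [hG_def, show 2 * j / 2 = j by omega]
      exact h4 y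
    · obtain ⟨h1, h2, h3, h4, -⟩ := hgV j (by omega)
      rw [hg_odd]
      refine ⟨h1, h2, by simpa [show (2 * j + 1) / 2 = j by omega] using h3, fun y => ?_⟩
      simp only [hG_def, show (2 * j + 1) / 2 = j by omega]
      exact h4 y
  have hG0 : ∀ k, 0 ≤ G k := fun k => by simp only [hG_def]; positivity
  -- Step 2: the pieces `W k` (classical homogeneous solutions on `[σ k, T']` from the comb data)
  have hfield : Torus.IsSmoothSpaceTimeOn (Ico 0 1) P.field := cascadeFieldSmooth P hδ₀ hd
  have hexW : ∀ k : ℕ, ∃ (W : ℝ → UnitAddTorus (Fin 2) → EuclideanSpace ℝ (Fin 2)) (R : ℝ → UnitAddTorus (Fin 2) → ℝ),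
      k < 2 * (J + 1) →
      (Torus.IsSmoothSpaceTimeOn (Icc (CascadeParams.tInject (k / 2) (k % 2 == 0)) T') W ∧
       Torus.IsSmoothSpaceTimeOn (Icc (CascadeParams.tInject (k / 2) (k % 2 == 0)) T') R ∧
       (∀ t ∈ Icc (CascadeParams.tInject (k / 2) (k % 2 == 0)) T', Torus.IsDivFree (W t)) ∧
       (∀ t ∈ Icc (CascadeParams.tInject (k / 2) (k % 2 == 0)) T', ∀ x,
          Torus.timeDerivWithin (Icc (CascadeParams.tInject (k / 2) (k % 2 == 0)) T') W t x +
            Torus.convect (P.field t) (W t) x + Torus.convect (W t) (P.field t) x =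
              ν • Torus.laplacian (W t) x - Torus.gradient (R t) x) ∧
       W (CascadeParams.tInject (k / 2) (k % 2 == 0)) =
         (if k % 2 = 0 then fun x => g k (Torus.repr x 1) • EuclideanSpace.single (0 : Fin 2) (1 : ℝ)
          else fun x => g k (Torus.repr x 0) • EuclideanSpace.single (1 : Fin 2) (1 : ℝ))) := by
    intro k
    by_cases hk : k < 2 * (J + 1)
    · have hab : CascadeParams.tInject (k / 2) (k % 2 == 0) < T' := by
        have h1 : CascadeParams.tInject (k / 2) (k % 2 == 0) < CascadeParams.tInject ((k + 1) / 2) ((k + 1) % 2 == 0) :=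
          slotStart_lt_succ k
        have h2 : CascadeParams.tInject ((k + 1) / 2) ((k + 1) % 2 == 0) ≤ tStart (J + 1) := by
          rw [← slotStart_even (J + 1)]; exact slotStart_mono (by omega)
        linarith
      have hI : Icc (CascadeParams.tInject (k / 2) (k % 2 == 0)) T' ⊆ Ico (0 : ℝ) 1 := fun s hs =>
        ⟨(slotStart_nonneg k).trans hs.1, hs.2.trans_lt hT'1⟩
      have hu := hfield.mono hI
      have hudiv : ∀ s ∈ Icc (CascadeParams.tInject (k / 2) (k % 2 == 0)) T', Torus.IsDivFree (P.field s) :=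
        fun s hs => DriftFreeExistence.isDivFree_field P (hI hs)
      obtain ⟨h1, h2, h3, -⟩ := hgk k hk
      by_cases hpar : k % 2 = 0
      · obtain ⟨W, R, hW, hR, hWdiv, -, -, hWlin, hW0⟩ :=
          Torus.linearisedNS_exists hν hab hu hudiv (isSmooth_parallelShear (k := 1) (m := 0) h2 h1)
            (isDivFree_parallelShear (k := 1) (m := 0) (by decide) h2) (hasZeroMean_comb_H (hN _) h1 h2 h3)
        exact ⟨W, R, fun _ => ⟨hW, hR, hWdiv, hWlin, by rw [if_pos hpar]; exact hW0⟩⟩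
      · obtain ⟨W, R, hW, hR, hWdiv, -, -, hWlin, hW0⟩ :=
          Torus.linearisedNS_exists hν hab hu hudiv (isSmooth_parallelShear (k := 0) (m := 1) h2 h1)
            (isDivFree_parallelShear (k := 0) (m := 1) (by decide) h2) (hasZeroMean_comb_V (hN _) h1 h2 h3)
        exact ⟨W, R, fun _ => ⟨hW, hR, hWdiv, hWlin, by rw [if_neg hpar]; exact hW0⟩⟩
    · exact ⟨fun _ _ => 0, fun _ _ => 0, fun h => absurd h hk⟩
  choose W R hWR using hexW
  -- Step 3: the envelope
  have hW0H : ∀ j, 2 * j < 2 * (J + 1) → W (2 * j) (tStart j) =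
      fun x => g (2 * j) (Torus.repr x 1) • EuclideanSpace.single (0 : Fin 2) (1 : ℝ) := by
    intro j hj
    have h := (hWR (2 * j) hj).2.2.2.2
    rw [slotStart_even, if_pos (Nat.mul_mod_right 2 j)] at h
    exact h
  have hW0V : ∀ j, 2 * j + 1 < 2 * (J + 1) → W (2 * j + 1) (tStart j + tHalf j) =
      fun x => g (2 * j + 1) (Torus.repr x 0) • EuclideanSpace.single (1 : Fin 2) (1 : ℝ) := by
    intro j hj
    have h := (hWR (2 * j + 1) hj).2.2.2.2
    rw [slotStart_odd, if_neg (by omega : ¬ (2 * j + 1) % 2 = 0)] at h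
    exact h
  have henv := response_phase_envelopeH P (W := W) (g := g) (G := G) hδ₀ hd hγ hN hν hC hK2ν hJT hL hq hLdiv hL0 hlin
    (fun k hk => ⟨(hgk k hk).1, (hgk k hk).2.1⟩) (fun k hk => (hgk k hk).2.2.1) hG0 (fun k hk => (hgk k hk).2.2.2)
    (fun j hj => by rw [hg_even]; exact (hgH j (by omega)).2.2.2.2)
    (fun j hj => by rw [hg_odd]; exact (hgV j (by omega)).2.2.2.2)
    (R := R) (fun i hi => (hWR i hi).1) (fun i hi => (hWR i hi).2.1) (fun i hi => (hWR i hi).2.2.1)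
    (fun i hi => (hWR i hi).2.2.2.1) hW0H hW0V hk ht
  refine henv.trans (add_le_add (Finset.sum_le_sum fun i hi => ?_) le_rfl)
  have hi' : i < 2 * (J + 1) := (Finset.mem_range.1 hi).trans hk
  have hE : 0 ≤ (C * Real.exp (sawSigmaStar * P.γ)) ^ (k / 2 + 1 - i / 2) :=
    pow_nonneg (mul_nonneg hC (Real.exp_pos _).le) _
  refine mul_le_mul_of_nonneg_left ?_ hE
  -- `G i ≤ 12 √π ν γ N/δ` from `1/δ' ≤ √2/δ`
  have hfac := (budget_facts (hδ (i / 2)) hν (tHalf_pos (i / 2)) (hN (i / 2)) (hbud (i / 2) (hkJ hi'))).2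
  have hN' : (0 : ℝ) ≤ (P.N (i / 2) : ℝ) := Nat.cast_nonneg _
  have hnum : 0 ≤ 6 * Real.sqrt (2 * Real.pi) * ν * (P.N (i / 2) : ℝ) * P.γ := by positivity
  simp only [hG_def]
  calc 6 * Real.sqrt (2 * Real.pi) * ν * (P.N (i / 2) : ℝ) * P.γ /
        Real.sqrt (P.δ (i / 2) ^ 2 - 8 * Real.pi ^ 2 * ν * (P.N (i / 2) : ℝ) ^ 2 * tHalf (i / 2))
      = 6 * Real.sqrt (2 * Real.pi) * ν * (P.N (i / 2) : ℝ) * P.γ *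
          (1 / Real.sqrt (P.δ (i / 2) ^ 2 - 8 * Real.pi ^ 2 * ν * (P.N (i / 2) : ℝ) ^ 2 * tHalf (i / 2))) := by
        ring
    _ ≤ 6 * Real.sqrt (2 * Real.pi) * ν * (P.N (i / 2) : ℝ) * P.γ * (Real.sqrt 2 / P.δ (i / 2)) :=
        mul_le_mul_of_nonneg_left hfac hnum
    _ = 6 * (Real.sqrt 2 * Real.sqrt 2) * Real.sqrt Real.pi * ν * (P.N (i / 2) : ℝ) * P.γ / P.δ (i / 2) := by
        rw [Real.sqrt_mul (by norm_num : (0 : ℝ) ≤ 2)]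
        ring
    _ = 12 * Real.sqrt Real.pi * ν * P.γ * (P.N (i / 2) : ℝ) / P.δ (i / 2) := by
        rw [Real.mul_self_sqrt (by norm_num : (0 : ℝ) ≤ 2)]
        ring

end Assembly

end Summit.AnomalousDissipation.AnomalousDissipation.Theorems.SawtoothPulseCascade.ApproxResponse

end
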